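import Literature.NumberTheory.IwasawaTheory.Greenberg2006.GreenbergCohomologyFactsOfTateEuler
import HarnessLib

/-!
# Greenberg 2006, Prop. 4.1 (`prop41_globalEulerPoincareCorank`) from the two textbook facts AT
# TOTALLY COMPLEX FIELDS ONLY: Milne I Thm. 5.1 and Harari Thm. 17.13 (a) for `K` totally complex

Topic `NumberTheory/IwasawaTheory/Greenberg2006`; namespace
`Literature.NumberTheory.IwasawaTheory.Greenberg2006`; THEOREMS ONLY (no definition, no named fact,
no `sorry`, no instance).

The named fact `prop41_globalEulerPoincareCorank` (Greenberg 2006 Prop. 4.1, the global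
Euler–Poincaré `Λ`-corank formula) is TYPED for `K` totally imaginary only (`∀ w : InfinitePlace K,
w.IsComplex`; module docstring of `GaloisCohomologyStructure`).  The tree derives it from Tate's
global Euler characteristic and Poitou–Tate 17.13 (a) quantified over EVERY number field
(`prop41_of_tate_of_poitouTate_three_le`), although its proof
(`prop41_of_step_of_tateGlobalEulerPoincareCharacteristic` ∘ `corankStep_of_finiteCoefficients`)
reads both facts at the totally imaginary `K` of the binders only: (E) Tate's identity at `K`
(`natCard_H_euler_of_forall_isComplex`), (V) `H^q(G_{K,S}, ·) = 0` for `q ≥ 3`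
(`subsingleton_H_of_two_lt_of_poitouTate_at`, 17.13 (a) at `K`), and (F) finiteness of
`Hⁿ(G_{K,S}, A)` in every degree (`finite_continuousCohomology_of_prime` on
`finite_restrictedCohomology K`, itself from the two facts at `K`:
`finite_restrictedCohomology_of_tate_of_poitouTate_three_le`).

This file records the sharper derivations:
* `prop41_of_tate_of_poitouTate_three_le_of_isTotallyComplex` — Prop. 4.1 from
  `∀ K [IsTotallyComplex K], tateGlobalEulerPoincareCharacteristic K` and
  `∀ K [IsTotallyComplex K], poitouTate_restricted_three_le K`;
* `prop41_of_tate_of_poitouTate_three_le_tc` — the same with Tate's fact for every number field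
  (the shape of a consumer that carries Milne I 5.1 unrestricted and Harari 17.13 (a) at totally
  complex fields, e.g. the Eisenstein-primes crux skeleton `halves` v28).

Use: Harari 17.13 (a) / Cor. 17.14 at TOTALLY COMPLEX fields is the target of a class-formation
proof in the tree (`RestrictedRamificationPoitouTateThreeLeOfCdTwo`, `RestrictedRamificationCdTwoOfH3Mu`);
with this file its landing discharges Prop. 4.1's Poitou–Tate input.

## References
* R. Greenberg, *On the structure of certain Galois cohomology groups*, Doc. Math. Extra Vol.
  Coates (2006) 335–391, §4 A Prop. 4.1 (p. 367 L40 – p. 368 L1) and its proof (p. 368). [Greenberg2006]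
* J. S. Milne, *Arithmetic Duality Theorems*, 2nd ed. (2006), I Thm. 5.1 (p. 67). [MilneADT2006]
* D. Harari, *Galois Cohomology and Class Field Theory* (2020), Thm. 17.13 (a), Cor. 17.14, Cor. 17.17
  (pp. 294–296). [Harari2020]
-/

noncomputable section

open scoped Classical
open NumberField IsDedekindDomain Field
open Literature.NumberTheory.GaloisRepresentations
open Literature.NumberTheory.GaloisCohomology
open Literature.NumberTheory.IwasawaTheory.Greenberg2016

namespace Literature.NumberTheory.IwasawaTheory.Greenberg2006

/-- **Greenberg 2006, Prop. 4.1 (`prop41_globalEulerPoincareCorank`) from Tate's global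
Euler–Poincaré characteristic and Poitou–Tate 17.13 (a) AT TOTALLY COMPLEX FIELDS ONLY.**  At the
binders (`K` with every infinite place complex) the one-prime step, the finiteness (F) and Tate's
identity (E) are read at that `K`: (F) in all degrees from `finite_restrictedCohomology K` ⟸ the two
facts at `K`; (V) from 17.13 (a) at `K`; (E) from 5.1 at `K`.
[cite: Greenberg2006, Prop. 4.1 (§4 A, p. 367 L40 – p. 368 L1) and its proof (p. 368)]
[cite: MilneADT2006, I Thm. 5.1 (p. 67)] [cite: Harari2020, Thm. 17.13 (a), Cor. 17.14, Cor. 17.17] -/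
theorem prop41_of_tate_of_poitouTate_three_le_of_isTotallyComplex
    (hT : ∀ (K : Type) [Field K] [NumberField K] [IsTotallyComplex K],
      tateGlobalEulerPoincareCharacteristic K)
    (ha : ∀ (K : Type) [Field K] [NumberField K] [IsTotallyComplex K],
      poitouTate_restricted_three_le K) :
    prop41_globalEulerPoincareCorank := by
  intro p _ K _ _ S hSf hSp hK Λ _ _ _ mΛ hΛ D _ _ _ _ _ ρ hpD hD m h₀ h₁ h₂ hm hh₀ hh₁ hh₂
  haveI : IsTotallyComplex K := ⟨hK⟩
  have hF : finite_restrictedCohomology K :=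
    finite_restrictedCohomology_of_tate_of_poitouTate_three_le (hT K) (ha K)
  have key := corankEuler_of_step_of_finiteEuler (Γ := GaloisGroupUnramifiedOutside K S) p
    (InfinitePlace.nrComplexPlaces K)
    (corankStep_of_finiteCoefficients (Γ := GaloisGroupUnramifiedOutside K S) p
      (fun _ _ _ _ _ _ _ _ _ _ τ hp n => finite_continuousCohomology_of_prime S τ hF hSf p hSp hp n)
      (fun _ _ _ _ _ _ _ _ _ _ τ hp _ hq =>
        subsingleton_H_of_two_lt_of_poitouTate_at (ha K) hK hSp τ hp hq))
    (fun R _ _ A _ _ _ _ _ _ τ hp n => finite_continuousCohomology_of_prime S τ hF hSf p hSp hp n)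
    (fun R _ _ A _ _ _ _ _ _ τ hp => natCard_H_euler_of_forall_isComplex S τ (hT K) hK hSf p hSp hp)
    hΛ ρ hpD hD hm hh₀ hh₁ hh₂
  rw [key, mul_comm]

/-- **Greenberg 2006, Prop. 4.1 from Tate's global Euler–Poincaré characteristic (every number field)
and Poitou–Tate 17.13 (a) at totally complex fields** — the hypothesis shape of a consumer carrying
Milne I Thm. 5.1 unrestricted and Harari Thm. 17.13 (a) restricted to totally complex fields.
[cite: Greenberg2006, Prop. 4.1 (§4 A, p. 367 L40 – p. 368 L1)] [cite: MilneADT2006, I Thm. 5.1 (p. 67)]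
[cite: Harari2020, Thm. 17.13 (a), Cor. 17.14] -/
theorem prop41_of_tate_of_poitouTate_three_le_tc
    (hT : ∀ (K : Type) [Field K] [NumberField K], tateGlobalEulerPoincareCharacteristic K)
    (ha : ∀ (K : Type) [Field K] [NumberField K] [IsTotallyComplex K],
      poitouTate_restricted_three_le K) :
    prop41_globalEulerPoincareCorank :=
  prop41_of_tate_of_poitouTate_three_le_of_isTotallyComplex (fun K _ _ _ => hT K) ha

/-- **`H^q(K_Σ/K, 𝒟) = 0` for `q ≥ 3` at an imaginary quadratic `K`** (every prime `p`), granted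
Harari 17.13 (a) at totally complex fields — the instance the Eisenstein-primes line reads.
[cite: Harari2020, Cor. 17.14 (p. 295)] [cite: Greenberg2006, §3 A (p. 359 L30–33)] -/
theorem subsingleton_H_of_two_lt_of_poitouTate_tc {K : Type} [Field K] [NumberField K]
    (ha : ∀ (K : Type) [Field K] [NumberField K] [IsTotallyComplex K],
      poitouTate_restricted_three_le K)
    [IsTotallyComplex K] {p : ℕ} [Fact p.Prime] {S : Set (HeightOneSpectrum (𝓞 K))}
    (hSp : ∀ v : HeightOneSpectrum (𝓞 K), ((p : ℕ) : 𝓞 K) ∈ v.asIdeal → v ∈ S)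
    {Λ : Type} [CommRing Λ] [TopologicalSpace Λ] [IsTopologicalRing Λ]
    {D : Type} [AddCommGroup D] [Module Λ D] [TopologicalSpace D] [DiscreteTopology D]
    [ContinuousSMul Λ D] (ρ : ContinuousRep (GaloisGroupUnramifiedOutside K S) Λ D)
    (hp : ∀ d : D, ∃ n : ℕ, (p ^ n : ℤ) • d = 0) {q : ℕ} (hq : 2 < q) : Subsingleton (ρ.H q) :=
  subsingleton_H_of_two_lt_of_poitouTate (ha K) p hSp ρ hp hq

/-- **`finite_restrictedCohomology K` (Harari Cor. 17.17 / NSW (8.3.20) (i)) at a totally complex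
`K`** from Milne I 5.1 (any field) and Harari 17.13 (a) at totally complex fields.
[cite: Harari2020, Cor. 17.17 (p. 295)] [cite: MilneADT2006, I Thm. 5.1 (p. 67)] -/
theorem finite_restrictedCohomology_of_tate_of_poitouTate_tc {K : Type} [Field K] [NumberField K]
    (hT : ∀ (K : Type) [Field K] [NumberField K], tateGlobalEulerPoincareCharacteristic K)
    (ha : ∀ (K : Type) [Field K] [NumberField K] [IsTotallyComplex K],
      poitouTate_restricted_three_le K)
    [IsTotallyComplex K] : finite_restrictedCohomology K :=
  finite_restrictedCohomology_of_tate_of_poitouTate_three_le (hT K) (ha K)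

end Literature.NumberTheory.IwasawaTheory.Greenberg2006

end
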